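/-
Copyright (c) 2026. All rights reserved.
Released under Apache 2.0 license as described in the file LICENSE.
Authors: abc-iut cell, seat abc-iut-w6-d025 (gen 2; block C / W6, row «Cor36-SHIFT-TELE»).
-/
import Literature.AnabelianGeometry.AbsoluteAnabelian.AbsTopIII.FrobeniusPictureMLFTelecoreShiftInvariance
import Literature.AnabelianGeometry.AbsoluteAnabelian.AbsTopIII.FrobeniusPictureMLFModel
import Literature.AnabelianGeometry.AbsoluteAnabelian.AbsTopIII.FrobeniusPictureMLFCompatibilityTransport
import Literature.AnabelianGeometry.AbsoluteAnabelian.AbsTopIII.AutHolLogFrobeniusCompatibility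
import Literature.AnabelianGeometry.AbsoluteAnabelian.DiagramMorphismPathIso
import Mathlib.Combinatorics.Quiver.Cast

/-!
# [AbsTopIII] Corollary 3.6 (v), fourth sentence DISCHARGED (modulo the hypotheses of (ii)):
# `shiftTelecoreCompatStmt_of_coherent`

S. Mochizuki, *Topics in Absolute Anabelian Geometry III*, Cor. 3.6 (v) p. 80 of the kurims
manuscript (`paper:url-5493eb38cbb7`; bib key `MochizukiAbsTopIII2015`), fourth sentence, read on
the page: "these self-equivalences also extend naturally [cf. the technique of extension applied in
Definition 3.5, (vi)] to the diagram of categories [cf. Definition 3.5, (iv), (a)] that constitutes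
the telecore of (ii), in a fashion that is compatible with both the family of homotopies that
constitutes this telecore structure [cf. Definition 3.5, (iv), (b)] and the contact structure `ℋ_An`
of (ii)" (proof, p. 82: "The remainder of assertion (v) follows immediately from the definitions").
Typed by seat abc-iut-L4-t5 as `LogFrobeniusData.ShiftTelecoreCompatStmt τ`
(`FrobeniusPictureMLFCompatibility.lean`, p419987).

Proof-only conclusion of `FrobeniusPictureMLFTelecoreShift.lean` (the extended shifts `Ψ_m =
teleShiftEquiv m` of `𝒟_An`) and `FrobeniusPictureMLFTelecoreShiftInvariance.lean` (the universal
family `K = anUniv τ hν` is invariant under them), after seat abc-iut-L4-t3's Cor. 5.5 (v) twin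
(`LogFrobeniusTelecoreShiftHolds.lean`).  Here: the shifts are bijective on paths
(`teleShift_mapPath_cast`); the boundary sets of the telecore family `𝒥` (the pairs
`([γ₃]∘[γ₁], [γ₃]∘[γ₂])` through `Anab`, `univE_obs_teleShift`) and of `ℋ_An` (the saturation of the
printed generators `{η_{□⋎}^{±1}, η_⋏^{±1}}`, indexed uniformly in `⋎`: `contactGen_teleShift`,
`saturation_teleShift`) are shift-stable, hence shift-INVARIANT (`teleShiftStable_iff`, inverse
shift); whence the Def. 3.5 (v) compatibility (`OneMorphism.CompatibleWith`, seat abc-iut-L4-t2; the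
path isomorphisms `Φ_{[γ]}` are seat abc-iut-f-102's `OneMorphism.pathIso`, with `eqToHom` components)
of every `Ψ_m` with every shift-stable restriction of `K` (`nonempty_compatibleWith_restrictBoundary`),
in particular with `𝒥` and `ℋ_An`; and **`shiftTelecoreCompatStmt_of_coherent`**: the typed
Cor. 3.6 (v), fourth sentence, holds for every `Δ` with fully faithful `id_⋎` and every coherent `τ`
— EXACTLY the hypotheses under which Cor. 3.6 (ii) itself is discharged
(`telecoreStmt_of_coherent`, whose telecore `anTelecore τ hν` and contact structure `anContact τ hν`
are the witnesses; the typed sentence re-quantifies the data of (ii)), with `Φ = shiftEquiv`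
(`isShiftAction_shiftEquiv`).  Seat abc-iut-L4-t10's Cor. 4.5 (v), fourth sentence, is literally
the same statement: `AbsTopIII.cor_4_5_v_compat_of_shiftCompat` assembles `Cor_4_5_v_compat` from it
and the third sentence (`ShiftCompatStmt`, row «Cor36-SHIFT» of seat abc-iut-w6-d023, taken as a
hypothesis here).  Pure category theory over the abstract data; OUR kernel check of a typed
statement of a refereed paper; nothing here takes a side on inter-universal Teichmüller theory or
bears on [IUTchIII] Cor. 3.12.
-/

namespace Literature.AnabelianGeometry.AbsoluteAnabelian

open _root_.CategoryTheory _root_.Quiver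

universe u v' w'

/-! ### Bookkeeping on paths -/

section Quivers

variable {V : Type w'} [Quiver.{v'} V]

/-- `mapPath` respects heterogeneous equality of paths with equal endpoints. [folklore] -/
private theorem Prefunctor.mapPath_heq' (F : V ⥤q V) {a b a' b' : V} (ha : a = a') (hb : b = b')
    {p : Quiver.Path a b} {p' : Quiver.Path a' b'} (h : HEq p p') : HEq (F.mapPath p) (F.mapPath p') := by
  subst ha hb; cases h; rfl

/-- Equal morphisms of oriented graphs have heterogeneously equal actions on paths. [folklore] -/
private theorem Prefunctor.mapPath_heq_of_eq' {P Q : V ⥤q V} (H : P = Q) {a b : V} (p : Quiver.Path a b) :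
    HEq (P.mapPath p) (Q.mapPath p) := by
  subst H; rfl

/-- Transport of a pair along a morphism of oriented graphs equal to the identity (bookkeeping). [folklore] -/
private theorem pair_of_eq_id {E : ∀ ⦃a b : V⦄, Quiver.Path a b → Quiver.Path a b → Prop} {P : V ⥤q V}
    (H : P = 𝟭q V) {a b : V} {p q : Quiver.Path a b} (h : E (P.mapPath p) (P.mapPath q)) : E p q := by
  subst H
  rw [Prefunctor.mapPath_id, Prefunctor.mapPath_id] at h
  exact h

end Quivers

namespace LogFrobeniusData

open DiagramOfCategories

/-! ### The shifts are bijective on paths; shift-stable boundary sets are shift-invariant -/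

/-- The shift by `m` reaches every path between shifted vertices: `Ψ (Ψ⁻¹ γ') = γ'`.
[cite: MochizukiAbsTopIII2015, Corollary 3.6 (v) p.80] -/
theorem teleShift_mapPath_cast (m : ℤ) {a b : (teleShape anJ.{u}).Vertex}
    (p' : Quiver.Path (teleShiftObj m a) (teleShiftObj m b)) :
    (teleShift m).mapPath (((teleShift (-m)).mapPath p').cast (teleShiftObj_neg_teleShiftObj m a)
      (teleShiftObj_neg_teleShiftObj m b)) = p' := by
  apply eq_of_heq
  refine (Prefunctor.mapPath_heq' (teleShift m) (teleShiftObj_neg_teleShiftObj m a).symm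
    (teleShiftObj_neg_teleShiftObj m b).symm (Path.cast_heq _ _ _)).trans ?_
  refine (heq_of_eq (Prefunctor.mapPath_comp_apply (teleShift (-m)) (teleShift m) p').symm).trans ?_
  exact (Prefunctor.mapPath_heq_of_eq' (teleShift_neg_comp m) p').trans
    (heq_of_eq (Prefunctor.mapPath_id p'))

/-- A boundary set on `Γ⃗_{𝒟_An}` closed under ALL shifts is shift-INVARIANT (use the inverse shift).
[cite: MochizukiAbsTopIII2015, Corollary 3.6 (v) p.80] -/
theorem teleShiftStable_iff {E : ∀ ⦃a b : (teleShape anJ.{u}).Vertex⦄, Quiver.Path a b → Quiver.Path a b → Prop}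
    (hE : ∀ (m : ℤ) ⦃a b : (teleShape anJ.{u}).Vertex⦄ ⦃p q : Quiver.Path a b⦄, E p q →
      E ((teleShift m).mapPath p) ((teleShift m).mapPath q))
    (m : ℤ) {a b : (teleShape anJ.{u}).Vertex} (p q : Quiver.Path a b) :
    E p q ↔ E ((teleShift m).mapPath p) ((teleShift m).mapPath q) := by
  refine ⟨fun h => hE m h, fun h => ?_⟩
  have h' := hE (-m) h
  rw [← Prefunctor.mapPath_comp_apply, ← Prefunctor.mapPath_comp_apply] at h'
  exact pair_of_eq_id (teleShift_comp_neg m) h'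

/-- The boundary set of the telecore family `𝒥` — the pairs `([γ₃]∘[γ₁], [γ₃]∘[γ₂])` through the core
vertex `Anab` (Def. 3.5 (iv) (b)) — is closed under the shifts. [cite: MochizukiAbsTopIII2015, Corollary 3.6 (v) p.80] -/
theorem univE_obs_teleShift (m : ℤ) ⦃a b : (teleShape anJ.{u}).Vertex⦄ ⦃p q : Quiver.Path a b⦄
    (h : univE (· = (teleShape anJ.{u}).obs) p q) :
    univE (· = (teleShape anJ.{u}).obs) ((teleShift m).mapPath p) ((teleShift m).mapPath q) := by
  obtain ⟨⟨w, hw, p₁, q₁, s, hp, hq⟩⟩ := h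
  subst hw
  exact ⟨⟨(teleShift m).obj (teleShape anJ.{u}).obs, rfl, (teleShift m).mapPath p₁,
    (teleShift m).mapPath q₁, (teleShift m).mapPath s,
    (congrArg (teleShift.{u} m).mapPath hp).trans (Prefunctor.mapPath_comp _ _ _),
    (congrArg (teleShift.{u} m).mapPath hq).trans (Prefunctor.mapPath_comp _ _ _)⟩⟩

/-- The saturation of a shift-stable set of pairs is shift-stable. [cite: MochizukiAbsTopIII2015, Corollary 3.6 (v) p.80] -/
theorem saturation_teleShift {E : ∀ ⦃a b : (teleShape anJ.{u}).Vertex⦄, Quiver.Path a b → Quiver.Path a b → Prop}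
    (hE : ∀ (m : ℤ) ⦃a b : (teleShape anJ.{u}).Vertex⦄ ⦃p q : Quiver.Path a b⦄, E p q →
      E ((teleShift m).mapPath p) ((teleShift m).mapPath q))
    (m : ℤ) ⦃a b : (teleShape anJ.{u}).Vertex⦄ ⦃p q : Quiver.Path a b⦄ (h : Saturation E p q) :
    Saturation E ((teleShift m).mapPath p) ((teleShift m).mapPath q) := by
  induction h with
  | base h => exact Saturation.base (hE m h)
  | refl_left _ ih => exact ih.refl_left
  | refl_right _ ih => exact ih.refl_right
  | trans _ _ ih₁ ih₂ => exact ih₁.trans ih₂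
  | precomp r _ ih =>
    rw [Prefunctor.mapPath_comp, Prefunctor.mapPath_comp]
    exact ih.precomp _
  | postcomp r _ ih =>
    rw [Prefunctor.mapPath_comp, Prefunctor.mapPath_comp]
    exact ih.postcomp _

/-! ### The printed generators of `ℋ_An` are permuted by the shifts -/

/-- The shifted generator path `[φ_□]`. [cite: MochizukiAbsTopIII2015, Corollary 3.6 (ii) p.79] -/
theorem teleShift_pathPhiNexus (m : ℤ) (j : anJ.{u} (vx 4 .nexus (by decide))) :
    (teleShift m).mapPath (pathPhiNexus j) =
      pathPhiNexus (anJShift m (vx 4 .nexus (by decide))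
        (LFVertex.shiftObj_mem_of_mem m (vx 4 LFVertex.nexus (by decide)).2) j) := rfl

/-- The shifted generator path `[id_⋎] ∘ [φ_⋎]` is `[id_{⋎+m}] ∘ [φ_{⋎+m}]`.
[cite: MochizukiAbsTopIII2015, Corollary 3.6 (ii) p.80] -/
theorem teleShift_pathPhiId (m n : ℤ) (jn : anJ.{u} (vx 4 (.row1 n) (by simp [LFVertex.row]))) :
    (teleShift m).mapPath (pathPhiId n jn) =
      pathPhiId (n + m) (anJShift m (vx 4 (.row1 n) (by simp [LFVertex.row]))
        (LFVertex.shiftObj_mem_of_mem m (by simp [LFVertex.row])) jn) := rfl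

/-- The shifted generator path `[β¹_□]`. [cite: MochizukiAbsTopIII2015, Corollary 3.6 (ii) p.79] -/
theorem teleShift_pathBetaNexus (m : ℤ) (j : anJ.{u} (vx 4 .nexus (by decide))) :
    (teleShift m).mapPath (pathBetaNexus j) =
      pathBetaNexus (anJShift m (vx 4 .nexus (by decide))
        (LFVertex.shiftObj_mem_of_mem m (vx 4 LFVertex.nexus (by decide)).2) j) := rfl

/-- The shifted generator path `[β¹_⋎]` is `[β¹_{⋎+m}]`. [cite: MochizukiAbsTopIII2015, Corollary 3.6 (ii) p.79] -/
theorem teleShift_pathBetaRow1 (m n : ℤ) (jn : anJ.{u} (vx 4 (.row1 n) (by simp [LFVertex.row]))) :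
    (teleShift m).mapPath (pathBetaRow1 n jn) =
      pathBetaRow1 (n + m) (anJShift m (vx 4 (.row1 n) (by simp [LFVertex.row]))
        (LFVertex.shiftObj_mem_of_mem m (by simp [LFVertex.row])) jn) := rfl

/-- **The printed generating pairs `{η_{□⋎}^{±1}, η_⋏^{±1}}_{⋎ ∈ L, ⋏ ∈ L†}` of `ℋ_An` form a shift-stable
set**: the shift by `m` sends the generator at `⋎` to the generator at `⋎ + m` and fixes those at
`□`. [cite: MochizukiAbsTopIII2015, Corollary 3.6 (ii) pp.79–80] -/
theorem contactGen_teleShift (m : ℤ) ⦃a b : (teleShape anJ.{u}).Vertex⦄ ⦃p q : Quiver.Path a b⦄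
    (h : ContactGen p q) : ContactGen ((teleShift m).mapPath p) ((teleShift m).mapPath q) := by
  cases h with
  | etaSq n j jn =>
    rw [teleShift_pathPhiNexus, teleShift_pathPhiId]
    exact ContactGen.etaSq (n + m) _ _
  | etaSqInv n j jn =>
    rw [teleShift_pathPhiNexus, teleShift_pathPhiId]
    exact ContactGen.etaSqInv (n + m) _ _
  | etaNexus j =>
    rw [teleShift_pathBetaNexus, Prefunctor.mapPath_nil]
    exact ContactGen.etaNexus _
  | etaNexusInv j =>
    rw [teleShift_pathBetaNexus, Prefunctor.mapPath_nil]
    exact ContactGen.etaNexusInv _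
  | etaRow1 n jn =>
    rw [teleShift_pathBetaRow1, Prefunctor.mapPath_nil]
    exact ContactGen.etaRow1 (n + m) _
  | etaRow1Inv n jn =>
    rw [teleShift_pathBetaRow1, Prefunctor.mapPath_nil]
    exact ContactGen.etaRow1Inv (n + m) _

/-! ### Def. 3.5 (v) compatibility of `Ψ_m` with the shift-stable restrictions of `K` -/

variable (Δ : LogFrobeniusData.{u}) (τ : Δ.TelecoreData) (hν : Δ.toNexus.FullyFaithful)

/-- **The extended shift `Ψ_m` is compatible (Def. 3.5 (v)) with every shift-stable restriction of the
universal family `K` of `𝒟_An`**: the shift induces a bijection of the boundary set onto itself, and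
the homotopies commute with the path isomorphisms `Φ_{[γ]}` (whose components are `eqToHom`s) — by the
invariance of `K` under the shifts (`teleShift_anUniv_η_heq`).
[cite: MochizukiAbsTopIII2015, Corollary 3.6 (v) p.80] -/
theorem nonempty_compatibleWith_restrictBoundary (m : ℤ)
    (E : ∀ ⦃a b : (teleShape anJ.{u}).Vertex⦄, Quiver.Path a b → Quiver.Path a b → Prop) (hE : IsSaturated E)
    (hsub : ∀ ⦃a b⦄ ⦃p q : Quiver.Path a b⦄, E p q → (Δ.anUniv τ hν).E p q)
    (hEst : ∀ (m : ℤ) ⦃a b : (teleShape anJ.{u}).Vertex⦄ ⦃p q : Quiver.Path a b⦄, E p q →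
      E ((teleShift m).mapPath p) ((teleShift m).mapPath q)) :
    Nonempty ((Δ.teleShiftMor τ m).CompatibleWith ((Δ.anUniv τ hν).restrictBoundary E hE hsub)
      ((Δ.anUniv τ hν).restrictBoundary E hE hsub)) :=
  ⟨{ pathIso := fun p => (Δ.teleShiftMor τ m).pathIso p
     pathIso_nil := fun a => OneMorphism.pathIso_nil _ a
     pathIso_cons := fun p e => OneMorphism.pathIso_cons _ p e
     boundary_iff := fun p q => teleShiftStable_iff hEst m p q
     boundary_surj := fun p' q' _ =>
       ⟨((teleShift (-m)).mapPath p').cast (teleShiftObj_neg_teleShiftObj m _)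
           (teleShiftObj_neg_teleShiftObj m _),
         ((teleShift (-m)).mapPath q').cast (teleShiftObj_neg_teleShiftObj m _)
           (teleShiftObj_neg_teleShiftObj m _),
         teleShift_mapPath_cast m p', teleShift_mapPath_cast m q'⟩
     η_compat := fun p q h => by
       ext x
       obtain ⟨h₁, e₁⟩ := OneMorphism.pathIso_hom_app_eq_eqToHom (Δ.teleShiftMor τ m)
         (fun e => Δ.teleShiftMor_iso_eq τ m e) p x
       obtain ⟨h₂, e₂⟩ := OneMorphism.pathIso_hom_app_eq_eqToHom (Δ.teleShiftMor τ m)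
         (fun e => Δ.teleShiftMor_iso_eq τ m e) q x
       have HEQ := Δ.teleShift_anUniv_η_heq τ hν m (hsub h)
         (hsub ((teleShiftStable_iff hEst m p q).mp h)) x
       rw [NatTrans.comp_app, NatTrans.comp_app, Functor.whiskerLeft_app, Functor.whiskerRight_app,
         e₁, e₂]
       refine (comp_eqToHom_iff h₂ _ _).2 ?_
       rw [Category.assoc]
       exact (conj_eqToHom_iff_heq _ _ h₁ h₂).2 HEQ }⟩

/-- `Ψ_m` is compatible with the telecore family `𝒥` of `𝔗_An` (= `K` restricted to the pairs through
`Anab`). [cite: MochizukiAbsTopIII2015, Corollary 3.6 (v) p.80] -/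
theorem nonempty_compatibleWith_Jfam (m : ℤ) :
    Nonempty ((Δ.teleShiftEquiv τ m).hom.CompatibleWith (Δ.anTelecore τ hν).Jfam
      (Δ.anTelecore τ hν).Jfam) :=
  Δ.nonempty_compatibleWith_restrictBoundary τ hν m _ (isSaturated_univE _) _ univE_obs_teleShift

/-- `Ψ_m` is compatible with the contact structure `ℋ_An` (= `K` restricted to the saturation of the
printed generators). [cite: MochizukiAbsTopIII2015, Corollary 3.6 (v) p.80] -/
theorem nonempty_compatibleWith_anContact (m : ℤ) :
    Nonempty ((Δ.teleShiftEquiv τ m).hom.CompatibleWith (Δ.anContact τ hν) (Δ.anContact τ hν)) :=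
  Δ.nonempty_compatibleWith_restrictBoundary τ hν m _ (isSaturated_saturation _) _
    (saturation_teleShift contactGen_teleShift)

/-! ### Corollary 3.6 (v), fourth sentence -/

/-- **[AbsTopIII] Cor. 3.6 (v), fourth sentence, PROVED over the abstract data** (modulo the
hypotheses under which (ii) is discharged): for every `Δ : LogFrobeniusData` whose `id_⋎ = toNexus`
is fully faithful (printed case `𝒳₁ = 𝒳`, `id_⋎ = 𝟭`) and every first-row telecore datum
`τ = (φ_⋎, e, η_⋎)` coherent with `η_An` (printed case `φ_⋎ = φ_An`, `e = 𝟙`, `η_⋎ = η_An`), over the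
telecore `𝔗_An` of the printed shape with its contact structure `ℋ_An` (the witnesses of
`telecoreStmt_of_coherent`), the nexus self-equivalences `Φ_m = shiftEquiv m` of `𝒟` extend to
self-equivalences `Ψ_m = teleShiftEquiv m` of `𝒟_An` — the same map and functors on `𝒟_{≤4}`, the
identity at `Anab` — compatible in the sense of Def. 3.5 (v) with the telecore family `𝒥` and with
`ℋ_An`. [cite: MochizukiAbsTopIII2015, Corollary 3.6 (v) p.80] -/
theorem shiftTelecoreCompatStmt_of_coherent (hν : Δ.toNexus.FullyFaithful)
    (hτ : ∀ x : Δ.X₁, Δ.toNexus.map (τ.η₁.hom.app x) =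
      τ.e.hom.app (Δ.κ.obj (Δ.XtoE.obj (Δ.toNexus.obj x))) ≫ Δ.η.hom.app (Δ.toNexus.obj x)) :
    Δ.ShiftTelecoreCompatStmt τ :=
  ⟨Δ.anCoreFamily, univCoreFamily_terminal _ _ _ _ _ _ _,
    univCoreObs_isCore coreShape5 (fun _ => inferInstanceAs (IsEmpty PEmpty)) Δ.coreExt5 Δ.overX Δ.φ
      Δ.anCI Δ.ffφ reaches5,
    Δ.anTelecore τ hν, Δ.anContact τ hν, Δ.anTelecore_isTelecoreAn τ hν,
    ⟨Δ.anContact_isContactStructure τ hν, Δ.anContact_isGeneratedBy τ hν,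
      fun n j jn h a e₁ e₂ => Δ.anContact_etaSq τ hν n j jn h a e₁ e₂,
      fun j h x e₁ e₂ => Δ.anContact_etaNexus τ hν j h x e₁ e₂,
      fun n jn h x e₁ e₂ => Δ.anContact_etaRow1 τ hν hτ n jn h x e₁ e₂⟩,
    Δ.shiftEquiv, Δ.teleShiftEquiv τ, Δ.isShiftAction_shiftEquiv,
    fun m a => Δ.teleShiftEquiv_base τ m a, fun m => Δ.teleShiftEquiv_obs τ m,
    fun m => ⟨Δ.nonempty_compatibleWith_Jfam τ hν m, Δ.nonempty_compatibleWith_anContact τ hν m⟩⟩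

/-- **[AbsTopIII] Cor. 4.5 (v), fourth sentence** (seat abc-iut-L4-t10's typing: the second conjunct
of `AbsTopIII.Cor_4_5_v_compat`, literally `ShiftTelecoreCompatStmt` on the archimedean data), PROVED
under the same hypotheses. [cite: MochizukiAbsTopIII2015, Corollary 4.5 (v) p.109] -/
theorem _root_.Literature.AnabelianGeometry.AbsoluteAnabelian.AbsTopIII.cor_4_5_v_shiftTelecoreCompat_of_coherent
    (hν : Δ.toNexus.FullyFaithful)
    (hτ : ∀ x : Δ.X₁, Δ.toNexus.map (τ.η₁.hom.app x) =
      τ.e.hom.app (Δ.κ.obj (Δ.XtoE.obj (Δ.toNexus.obj x))) ≫ Δ.η.hom.app (Δ.toNexus.obj x)) :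
    Δ.ShiftTelecoreCompatStmt τ :=
  Δ.shiftTelecoreCompatStmt_of_coherent τ hν hτ

/-- **Cor. 4.5 (v), third and fourth sentences assembled** (`AbsTopIII.Cor_4_5_v_compat Δ τ =
ShiftCompatStmt ∧ ShiftTelecoreCompatStmt τ`): given the third sentence (`ShiftCompatStmt`, the
compatibility of the `Φ_m` with a family realising the cores and `𝔖_log` — NOT proved here), the
clause holds under the hypotheses of (ii). [cite: MochizukiAbsTopIII2015, Corollary 4.5 (v) p.109] -/
theorem _root_.Literature.AnabelianGeometry.AbsoluteAnabelian.AbsTopIII.cor_4_5_v_compat_of_shiftCompat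
    (hν : Δ.toNexus.FullyFaithful)
    (hτ : ∀ x : Δ.X₁, Δ.toNexus.map (τ.η₁.hom.app x) =
      τ.e.hom.app (Δ.κ.obj (Δ.XtoE.obj (Δ.toNexus.obj x))) ≫ Δ.η.hom.app (Δ.toNexus.obj x))
    (h₃ : Δ.ShiftCompatStmt) : AbsTopIII.Cor_4_5_v_compat Δ τ :=
  ⟨h₃, Δ.shiftTelecoreCompatStmt_of_coherent τ hν hτ⟩

end LogFrobeniusData

/-! ### Unconditional at the printed shape of the data; at the MLF-Galois `TF`-model -/

namespace MonoAnabelianLogFrobeniusData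

variable (𝔐 : MonoAnabelianLogFrobeniusData.{u})

/-- **[AbsTopIII] Cor. 3.6 (v), fourth sentence, at the printed shape of the data — UNCONDITIONAL**:
for the `LogFrobeniusData` built from Def.-3.1-shaped inputs (first row `𝒳`, `id_⋎ = 𝟭`) and the
printed telecore datum `⟨φ_An, 𝟙, η_An⟩` (seat abc-iut-L4-t5's `FrobeniusPictureMLFInputs.lean`, where
Cor. 3.6 (ii) is unconditional likewise: `telecoreStmt`), both hypotheses of
`shiftTelecoreCompatStmt_of_coherent` are discharged (`toNexusFullyFaithful`, `telecoreData_coherent`).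
[cite: MochizukiAbsTopIII2015, Corollary 3.6 (v) p.80] -/
theorem shiftTelecoreCompatStmt :
    𝔐.toLogFrobeniusData.ShiftTelecoreCompatStmt 𝔐.telecoreData :=
  𝔐.toLogFrobeniusData.shiftTelecoreCompatStmt_of_coherent 𝔐.telecoreData 𝔐.toNexusFullyFaithful
    𝔐.telecoreData_coherent

end MonoAnabelianLogFrobeniusData

namespace AbsTopIII.TFModel

variable {p : ℕ} [Fact p.Prime] {P : ObjectProperty (TFModel p)} {D : Type 1} [Category.{1} D]

/-- **[AbsTopIII] Cor. 3.6 (v), fourth sentence, AT THE MODEL** `𝒳 = 𝒞^{MLF-sB}_{TF}` (seat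
abc-iut-L4-t5's `FrobeniusPictureMLFModel.lean`, alongside `telecoreStmt_model`): unconditional.
[cite: MochizukiAbsTopIII2015, Corollary 3.6 (v) p.80] -/
theorem shiftTelecoreCompatStmt_model (I : AnabelianInput p P D) :
    (monoAnabelianData I).toLogFrobeniusData.ShiftTelecoreCompatStmt (monoAnabelianData I).telecoreData :=
  (monoAnabelianData I).shiftTelecoreCompatStmt

end AbsTopIII.TFModel

end Literature.AnabelianGeometry.AbsoluteAnabelian
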